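import Literature.NumberTheory.QuadraticFields.RamifiedPrimeNotPrincipal
import HarnessLib

/-!
# A product of ramified primes of `ℚ(√-n)` above distinct proper prime divisors is not principal when a further ramified prime exists

Topic `NumberTheory/QuadraticFields`, namespace `Literature.NumberTheory.QuadraticFields.RedeiReichardt`.
Theorem-only file (no definition, no named fact), the `t′`-prime generalisation of
`RamifiedPrimeNotPrincipal.lean` (`not_isPrincipal_of_sq_eq_span`, one prime) and
`RamifiedPrimePairNotPrincipal.lean` (`not_isPrincipal_mul_of_sq_eq_span`, two primes), again a corollary of
the tree's Stevenhagen §2 lemma `eq_zero_or_eq_indicator_of_isPrincipal` (`RedeiReichardtPrincipalAmbiguous`: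
a principal product of ramified primes of `K ∋ √-n` is `(1)` or `(√-n) = ∏_{p ∣ n} 𝔭_p`).

Let `K` be a quadratic field containing `x` with `x² = -n`, `n` square-free; let `q_j` (`j ∈ Fin t′`) be
DISTINCT primes dividing `n` with ramified primes `𝔔_j` (`𝔔_j² = (q_j)`), and suppose a further prime `r ∣ n`
with `r ≠ q_j` for all `j` exists.  **Then for every non-zero exponent vector `ε : Fin t′ → ℤ/2` the product
`∏_j 𝔔_j^{ε_j}` is not principal** (`not_isPrincipal_prod_pow_of_sq_eq_span`), equivalently
`∏_j [𝔔_j]^{ε_j} ≠ 1` in `Cl(𝒪_K)` (`prod_classGroupMk0_pow_ne_one_of_sq_eq_span`): its exponent vector on the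
primes of `disc K` is the extension of `ε` by zero — neither `0` (`ε ≠ 0`) nor the indicator of all primes of
`n` (it misses `r`).  Equivalently: the classes `[𝔔_j]` are INDEPENDENT in `Cl(𝒪_K)[2]` as long as one ramified
prime of `n` is left out.  Use (cell `bsd-print-cf2`, crux stmt-BirchSwinnertonDyer-20509, even blocks
`d = 2d′`, `r = 2`, the `q_j` odd): by Artin reciprocity for the Hilbert class field (Cox Cor. 5.25) a PRODUCT
`∏_{j ∈ U} Frob(𝔭_{q_j})` (`U ≠ ∅`) in a ring class field of `ℚ(√-d)` is non-trivial on the Hilbert class field.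

## References

* P. Stevenhagen, *Rédei-matrices and applications*, LMS LNS 215 (1995), §2 (proof of Thm. 1).
  [Stevenhagen1995RedeiMatrices]
* D. A. Cox, *Primes of the form x² + ny²*, 2nd ed. (2013), §5.C Thm. 5.23, Cor. 5.25 (PDF p. 124); §3.B
  Thm. 3.15 / §6.A (genus theory: the classes of the ramified primes generate `Cl[2]` with one relation).
  [Cox2013]

## Mathlib / tree search

Tree: `RedeiReichardt.eq_zero_or_eq_indicator_of_isPrincipal`, `exists_sq_eq_span`,
`eq_of_sq_eq_span_of_mem`, `isMaximal_of_sq_eq_span`, `mem_nonZeroDivisors_of_sq_eq_span`,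
`sq_span_pair_eq_span`.  Mathlib: `Function.extend` (`Injective.extend_apply`, `extend_apply'`),
`Finset.prod_subset`, `Finset.prod_image`, `ClassGroup.mk0_eq_one_iff`.
-/

noncomputable section

open NumberField Ideal Module
open scoped nonZeroDivisors

namespace Literature.NumberTheory.QuadraticFields.RedeiReichardt

variable {K : Type*} [Field K] [NumberField K]

/-- **A product of ramified primes above distinct proper prime divisors of `n`, with a non-zero exponent vector
mod `2`, is not principal, given a further prime of `n`.**  `K ∋ x`, `x² = -n` (`n` square-free),
`q : Fin t′ → ℕ` injective with `q_j ∣ n` prime, `𝔔_j² = (q_j)`, a prime `r ∣ n` with `r ≠ q_j` (all `j`), and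
`ε : Fin t′ → ZMod 2`, `ε ≠ 0`.  Proof: enumerate the primes of `disc K` with their ramified primes `𝔭_i`;
`𝔔_j = 𝔭_{ι j}` for an injection `ι`; `∏_j 𝔔_j^{ε_j}` is the product with exponent vector `ext ι ε 0`; were it
principal, Stevenhagen's lemma would make that vector `0` (so `ε = 0`) or the indicator of `{i : p_i ∣ n}`
(false at the index of `r`).
[cite: Stevenhagen1995RedeiMatrices, §2 (proof of Thm. 1)] [cite: Cox2013, §5.C Cor. 5.25 (PDF p. 124)] -/
theorem not_isPrincipal_prod_pow_of_sq_eq_span (h2 : finrank ℚ K = 2) {n : ℕ} (hn : Squarefree n)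
    {x : 𝓞 K} (hx : x ^ 2 = -(n : 𝓞 K)) {t' : ℕ} {q : Fin t' → ℕ} (hq : ∀ j, (q j).Prime)
    (hqinj : Function.Injective q) (hqn : ∀ j, q j ∣ n) {r : ℕ} (hr : r.Prime) (hrn : r ∣ n)
    (hrq : ∀ j, r ≠ q j) {Q : Fin t' → Ideal (𝓞 K)} (hQ : ∀ j, Q j ^ 2 = span {(q j : 𝓞 K)})
    {ε : Fin t' → ZMod 2} (hε : ε ≠ 0) :
    ¬ (∏ j, Q j ^ (ε j).val).IsPrincipal := by
  classical
  intro hprinc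
  -- `n ∉ {0, 1, 3}`
  have hn1 : n ≠ 1 := by rintro rfl; exact hr.ne_one (Nat.dvd_one.mp hrn)
  have hn3 : n ≠ 3 := by
    rintro rfl
    obtain ⟨j, hj⟩ := Function.ne_iff.mp hε
    have e1 := (Nat.prime_dvd_prime_iff_eq hr Nat.prime_three).mp hrn
    have e2 := (Nat.prime_dvd_prime_iff_eq (hq j) Nat.prime_three).mp (hqn j)
    exact hrq j (e1.trans e2.symm)
  have hn0 : n ≠ 0 := Squarefree.ne_zero hn
  -- the primes of the discriminant
  set m : ℕ := if n % 4 = 1 then 2 * n else n with hm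
  have hnm : n ∣ m := by rw [hm]; split_ifs; exacts [Dvd.intro_left 2 rfl, dvd_rfl]
  have hm0 : m ≠ 0 := by rw [hm]; split_ifs <;> omega
  have hmsq : Squarefree m := by
    rw [hm]
    split_ifs with h4
    · exact Nat.squarefree_mul_iff.mpr
        ⟨Nat.coprime_two_left.mpr (Nat.odd_iff.mpr (by omega)), Nat.squarefree_two, hn⟩
    · exact hn
  set e := m.primeFactors.equivFin with he
  set t : ℕ := m.primeFactors.card with ht
  let p : Fin t → ℕ := fun i => ((e.symm i : m.primeFactors) : ℕ)
  have hp : ∀ i, (p i).Prime := fun i => Nat.prime_of_mem_primeFactors (e.symm i).2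
  have hinj : Function.Injective p := Subtype.val_injective.comp e.symm.injective
  have hprod : ∏ i, p i = m := by
    calc ∏ i, p i = ∏ s : m.primeFactors, (s : ℕ) := Fintype.prod_equiv e.symm _ _ fun _ => rfl
      _ = ∏ s ∈ m.primeFactors, s := Finset.prod_coe_sort m.primeFactors (fun j : ℕ => j)
      _ = m := Nat.prod_primeFactors_of_squarefree hmsq
  choose P' hP' using fun i => exists_sq_eq_span hx hp hinj hprod i
  have hpe : ∀ (a : ℕ) (ha : a ∈ m.primeFactors), p (e ⟨a, ha⟩) = a := fun a ha => by
    show ((e.symm (e ⟨a, ha⟩) : m.primeFactors) : ℕ) = a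
    rw [Equiv.symm_apply_apply]
  -- the indices of the `q_j` and of `r`
  have hqm : ∀ j, q j ∈ m.primeFactors := fun j => Nat.mem_primeFactors.mpr ⟨hq j, (hqn j).trans hnm, hm0⟩
  have hrm : r ∈ m.primeFactors := Nat.mem_primeFactors.mpr ⟨hr, hrn.trans hnm, hm0⟩
  let ι : Fin t' → Fin t := fun j => e ⟨q j, hqm j⟩
  have hι : Function.Injective ι := fun j j' h =>
    hqinj (congrArg (fun s : m.primeFactors => (s : ℕ)) (e.injective h))
  set iᵣ : Fin t := e ⟨r, hrm⟩ with hiᵣ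
  have hrι : ¬ ∃ j, ι j = iᵣ := by
    rintro ⟨j, hj⟩
    exact hrq j (congrArg (fun s : m.primeFactors => (s : ℕ)) (e.injective hj)).symm
  -- `𝔔_j = 𝔭_{ι j}`
  have hQeq : ∀ j, Q j = P' (ι j) := fun j =>
    eq_of_sq_eq_span_of_mem h2 (hp (ι j)) (hP' (ι j)) (isMaximal_of_sq_eq_span h2 (hq j) (hQ j)).isPrime
      ((hpe (q j) (hqm j)).symm ▸ Ideal.pow_le_self two_ne_zero ((hQ j) ▸ mem_span_singleton_self _))
  -- the exponent vector: `ε` extended by zero along `ι`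
  let e₀ : Fin t → ZMod 2 := Function.extend ι ε 0
  have he₀ι : ∀ j, e₀ (ι j) = ε j := fun j => hι.extend_apply ε 0 j
  have he₀out : ∀ i, (¬ ∃ j, ι j = i) → e₀ i = 0 := fun i hi => by
    show Function.extend ι ε 0 i = 0
    rw [Function.extend_apply' (f := ι) ε (0 : Fin t → ZMod 2) i hi, Pi.zero_apply]
  have hprodeq : ∏ i, P' i ^ (e₀ i).val = ∏ j, Q j ^ (ε j).val := by
    rw [← Finset.prod_subset (Finset.subset_univ (Finset.univ.image ι)) (fun i _ hi => by
      have hi' : ¬ ∃ j, ι j = i := fun ⟨j, hj⟩ => hi (Finset.mem_image.mpr ⟨j, Finset.mem_univ _, hj⟩)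
      rw [he₀out i hi', ZMod.val_zero, pow_zero]),
      Finset.prod_image (fun j _ j' _ h => hι h)]
    exact Finset.prod_congr rfl fun j _ => by rw [he₀ι, hQeq]
  have hprinc' : (∏ i, P' i ^ (e₀ i).val).IsPrincipal := by rwa [hprodeq]
  rcases eq_zero_or_eq_indicator_of_isPrincipal h2 hx hp hinj hprod hP' hn1 hn3 e₀ hprinc' with h0 | h1
  · apply hε
    funext j
    rw [← he₀ι j, h0]; rfl
  · have := congr_fun h1 iᵣ
    rw [he₀out iᵣ hrι, hpe r hrm, if_pos hrn] at this
    exact zero_ne_one this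

/-- **Class-group form**: with the same data, `∏_j [𝔔_j]^{ε_j} ≠ 1` in `Cl(𝒪_K)` — the classes of the ramified
primes above `t′` distinct primes of `n` omitting a further one are independent in `Cl(𝒪_K)[2]`.
[cite: Stevenhagen1995RedeiMatrices, §2 (proof of Thm. 1)] [cite: Cox2013, §5.C Cor. 5.25 (PDF p. 124)] -/
theorem prod_classGroupMk0_pow_ne_one_of_sq_eq_span (h2 : finrank ℚ K = 2) {n : ℕ} (hn : Squarefree n)
    {x : 𝓞 K} (hx : x ^ 2 = -(n : 𝓞 K)) {t' : ℕ} {q : Fin t' → ℕ} (hq : ∀ j, (q j).Prime)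
    (hqinj : Function.Injective q) (hqn : ∀ j, q j ∣ n) {r : ℕ} (hr : r.Prime) (hrn : r ∣ n)
    (hrq : ∀ j, r ≠ q j) {Q : Fin t' → Ideal (𝓞 K)} (hQ : ∀ j, Q j ^ 2 = span {(q j : 𝓞 K)})
    (hQ0 : ∀ j, Q j ∈ (Ideal (𝓞 K))⁰) {ε : Fin t' → ZMod 2} (hε : ε ≠ 0) :
    ∏ j, ClassGroup.mk0 ⟨Q j, hQ0 j⟩ ^ (ε j).val ≠ 1 := by
  intro h
  have h' : ClassGroup.mk0 (∏ j, (⟨Q j, hQ0 j⟩ : (Ideal (𝓞 K))⁰) ^ (ε j).val) = 1 := by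
    rw [map_prod]
    simpa only [map_pow] using h
  rw [ClassGroup.mk0_eq_one_iff] at h'
  refine not_isPrincipal_prod_pow_of_sq_eq_span h2 hn hx hq hqinj hqn hr hrn hrq hQ hε ?_
  simpa only [Submonoid.coe_finsetProd, SubmonoidClass.coe_pow] using h'

/-- **Explicit form** with `𝔔_j := (q_j, √-n)` (`(q_j, x)² = (q_j)` by `sq_span_pair_eq_span`): for distinct primes
`q_j ∣ n`, a further prime `r ∣ n`, and `ε ≠ 0`, `∏_j (q_j, x)^{ε_j}` is not principal.
[cite: Stevenhagen1995RedeiMatrices, §2 (proof of Thm. 1)] [cite: Cox2013, §5.C Cor. 5.25 (PDF p. 124)] -/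
theorem not_isPrincipal_prod_span_pair_pow (h2 : finrank ℚ K = 2) {n : ℕ} (hn : Squarefree n)
    {x : 𝓞 K} (hx : x ^ 2 = -(n : 𝓞 K)) {t' : ℕ} {q : Fin t' → ℕ} (hq : ∀ j, (q j).Prime)
    (hqinj : Function.Injective q) (hqn : ∀ j, q j ∣ n) {r : ℕ} (hr : r.Prime) (hrn : r ∣ n)
    (hrq : ∀ j, r ≠ q j) {ε : Fin t' → ZMod 2} (hε : ε ≠ 0) :
    ¬ (∏ j, (span {(q j : 𝓞 K), x} : Ideal (𝓞 K)) ^ (ε j).val).IsPrincipal :=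
  not_isPrincipal_prod_pow_of_sq_eq_span h2 hn hx hq hqinj hqn hr hrn hrq
    (fun j => sq_span_pair_eq_span hn hx (hq j) (hqn j)) hε

end Literature.NumberTheory.QuadraticFields.RedeiReichardt

end
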